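import Summits.KontsevichZagierPeriods.KontsevichZagierPeriods.Theorems.TerasomaMultiplicationBetaCancellationStubFibreSubstitutionAE

/-!
# `BetaCancellation` (stmt-KontsevichZagierPeriods-13633), line `dirichlet-companion-to-pi` — stub `stub_swapSubstitutionAE` (seat c15): THE MEASURE CORE OF SWAP SUBSTITUTIONS

**Swap substitutions — the maximally tilting one-move certificates.** Let `p = [K, k]` be a catalyst
and `q = p ⊗ r`, `q' = p ⊗ r'` pinned products (catalyst first, `Fin.castAdd d i`; factor last,
`Fin.natAdd d j`) with bases `r = [σ, f]`, `r' = [σ', f']` of the SAME dimension `d` as the catalyst.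
A change of variables `Φ : q → q'` is of SWAP FORM if it exchanges the roles of catalyst and base:
`head (Φ (x, w)) = α w` and `tail (Φ (x, w)) = β x` for maps `α : σ → K`, `β : K → σ'` (injective,
differentiable within their domains). The crux notes (c11 H5, c12 I1, c14 K4) single out substitutions
whose base part depends on the catalyst coordinate as the open one-move core; a swap is the extreme
case — the base part depends ONLY on the catalyst coordinate. This file is its measure core
(`stub_swapSubstitutionAE`): testing the change-of-variables formula for `Φ` on the cylinders `A × B`
(`A ⊆ K`, `B ⊆ σ` measurable; `Φ (A × B) = α B × β A`, `swap_image_cylinder`) and evaluating both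
sides by Fubini gives the EXCHANGE IDENTITY `(∫_{αB} k)(∫_{βA} f') = (∫_A k)(∫_B f)`
(`swap_exchange_identity`); with `A = K` resp. `B = σ` and the change of variables for `α` on `B`
resp. `β` on `A` it yields `r'.value = r.value` and the two SCALED a.e. Jacobian identities
`r.value · (k ∘ α)|det α'| = p.value · f` on `σ` and `p.value · (f' ∘ β)|det β'| = r.value · k` on `K`.
The descent (`…SwapSubstitution.lean`): the scale `r.value / p.value` is ALGEBRAIC
(`isAlgebraic_of_ae_scaledJacobian`), so `r ∼ (r.value/p.value) · p ∼ r'`. No definitions; sorry-free;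
axioms ⊆ {propext, Classical.choice, Quot.sound}.

References: M. Kontsevich, D. Zagier, *Periods* (2001), §1.2 rule (2), §4.1 ("Fubini formula").
-/

noncomputable section

-- `Summit.KontsevichZagierPeriods.KontsevichZagierPeriods.…` is the tree's mandated layout (single-conjunct summit).
set_option linter.dupNamespace false

namespace Summit.KontsevichZagierPeriods.KontsevichZagierPeriods.BetaCancellationLine

open MeasureTheory Set
open Literature.NumberTheory.Transcendental
open Literature.NumberTheory.Transcendental.KZ

/-! ### Cylinders under a swap -/

/-- **A swap maps the cylinder `A × B` onto `α B × β A`.** [folklore] -/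
theorem swap_image_cylinder {d : ℕ} {K A σ B : Set (Fin d → ℝ)} {D : Set (Fin (d + d) → ℝ)}
    (hD : D = {z | (fun i => z (Fin.castAdd d i)) ∈ K ∧ (fun j => z (Fin.natAdd d j)) ∈ σ})
    (Φ : (Fin (d + d) → ℝ) → (Fin (d + d) → ℝ)) (α β : (Fin d → ℝ) → (Fin d → ℝ))
    (hhead : ∀ z ∈ D, (fun i => Φ z (Fin.castAdd d i)) = α (fun j => z (Fin.natAdd d j)))
    (htail : ∀ z ∈ D, (fun j => Φ z (Fin.natAdd d j)) = β (fun i => z (Fin.castAdd d i)))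
    (hA : A ⊆ K) (hB : B ⊆ σ) :
    Φ '' (appendMeasurableEquiv d d '' (A ×ˢ B)) =
      appendMeasurableEquiv d d '' ((α '' B) ×ˢ (β '' A)) := by
  have hmemD : ∀ z, z ∈ D ↔
      (fun i => z (Fin.castAdd d i)) ∈ K ∧ (fun j => z (Fin.natAdd d j)) ∈ σ := fun z => by
    rw [hD]; rfl
  apply Subset.antisymm
  · rintro _ ⟨z, hz, rfl⟩
    rw [fibreAE_mem_image_prod] at hz ⊢
    have hzD : z ∈ D := (hmemD z).2 ⟨hA hz.1, hB hz.2⟩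
    rw [hhead z hzD, htail z hzD]
    exact ⟨mem_image_of_mem α hz.2, mem_image_of_mem β hz.1⟩
  · intro z' hz'
    rw [fibreAE_mem_image_prod] at hz'
    obtain ⟨⟨b, hb, hb'⟩, ⟨a, ha, ha'⟩⟩ := hz'
    have hmemS : Fin.append a b ∈ appendMeasurableEquiv d d '' (A ×ˢ B) := by
      rw [fibreAE_mem_image_prod]
      simp only [Fin.append_left, Fin.append_right]
      exact ⟨ha, hb⟩
    have hzD : Fin.append a b ∈ D := by
      refine (hmemD _).2 ?_
      simp only [Fin.append_left, Fin.append_right]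
      exact ⟨hA ha, hB hb⟩
    refine ⟨Fin.append a b, hmemS, ?_⟩
    have h1 := hhead _ hzD
    have h2 := htail _ hzD
    simp only [Fin.append_left, Fin.append_right] at h1 h2
    rw [← Fin.append_castAdd_natAdd (f := Φ (Fin.append a b)), ← Fin.append_castAdd_natAdd (f := z')]
    congr 1
    · rw [h1]
      exact hb'
    · rw [h2]
      exact ha'

/-! ### The exchange identity -/

/-- **Exchange identity of a swap substitution.** For ONE change of variables `Φ : p ⊗ r → p ⊗ r'`
of swap form (`head ∘ Φ = α ∘ tail`, `tail ∘ Φ = β ∘ head`, `α`, `β` injective with derivatives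
within `σ` resp. `K`) and measurable `A ⊆ K`, `B ⊆ σ`:
`(∫_{α B} k) · (∫_{β A} f') = (∫_A k) · (∫_B f)` — the change-of-variables formula for `Φ` on the
cylinder `A × B`, whose image is the cylinder `α B × β A`, both sides evaluated by Fubini.
[cite: KontsevichZagier2001, §4.1] -/
theorem swap_exchange_identity {d : ℕ} (p r r' : IntegralRep d) (q q' : IntegralRep (d + d))
    (hq : q.domain = {z | (fun i => z (Fin.castAdd d i)) ∈ p.domain ∧
      (fun j => z (Fin.natAdd d j)) ∈ r.domain})
    (hqi : Set.EqOn q.integrand (fun z => p.integrand (fun i => z (Fin.castAdd d i)) *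
      r.integrand (fun j => z (Fin.natAdd d j))) q.domain)
    (hq'i : Set.EqOn q'.integrand (fun z => p.integrand (fun i => z (Fin.castAdd d i)) *
      r'.integrand (fun j => z (Fin.natAdd d j))) q'.domain)
    (Φ : (Fin (d + d) → ℝ) → (Fin (d + d) → ℝ))
    (Φ' : (Fin (d + d) → ℝ) → (Fin (d + d) → ℝ) →L[ℝ] (Fin (d + d) → ℝ))
    (hΦ' : ∀ z ∈ q.domain, HasFDerivWithinAt Φ (Φ' z) q.domain z) (hΦinj : Set.InjOn Φ q.domain)
    (himg : q'.domain = Φ '' q.domain)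
    (hjac : ∀ z ∈ q.domain, q.integrand z = q'.integrand (Φ z) * |(Φ' z).det|)
    (α β : (Fin d → ℝ) → (Fin d → ℝ)) (α' β' : (Fin d → ℝ) → (Fin d → ℝ) →L[ℝ] (Fin d → ℝ))
    (hhead : ∀ z ∈ q.domain, (fun i => Φ z (Fin.castAdd d i)) = α (fun j => z (Fin.natAdd d j)))
    (htail : ∀ z ∈ q.domain, (fun j => Φ z (Fin.natAdd d j)) = β (fun i => z (Fin.castAdd d i)))
    (hα' : ∀ w ∈ r.domain, HasFDerivWithinAt α (α' w) r.domain w)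
    (hβ' : ∀ x ∈ p.domain, HasFDerivWithinAt β (β' x) p.domain x)
    (hαinj : Set.InjOn α r.domain) (hβinj : Set.InjOn β p.domain)
    {A : Set (Fin d → ℝ)} (hAm : MeasurableSet A) (hA : A ⊆ p.domain)
    {B : Set (Fin d → ℝ)} (hBm : MeasurableSet B) (hB : B ⊆ r.domain) :
    (∫ x in α '' B, p.integrand x) * (∫ w in β '' A, r'.integrand w) =
      (∫ x in A, p.integrand x) * ∫ w in B, r.integrand w := by
  have hmemq : ∀ z, z ∈ q.domain ↔ (fun i => z (Fin.castAdd d i)) ∈ p.domain ∧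
      (fun j => z (Fin.natAdd d j)) ∈ r.domain := fun z => by rw [hq]; rfl
  -- the cylinder `S = A × B ⊆ q.domain` and its image `S' = α B × β A ⊆ q'.domain`
  have hSm : MeasurableSet (appendMeasurableEquiv d d '' (A ×ˢ B)) :=
    fibreAE_measurableSet_image_prod hAm hBm
  have hSq : appendMeasurableEquiv d d '' (A ×ˢ B) ⊆ q.domain := by
    intro z hz
    rw [fibreAE_mem_image_prod] at hz
    rw [hmemq]
    exact ⟨hA hz.1, hB hz.2⟩
  have hαc : ContinuousOn α r.domain := fun w hw => (hα' w hw).continuousWithinAt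
  have hβc : ContinuousOn β p.domain := fun x hx => (hβ' x hx).continuousWithinAt
  have hαBm : MeasurableSet (α '' B) :=
    hBm.image_of_continuousOn_injOn (hαc.mono hB) (hαinj.mono hB)
  have hβAm : MeasurableSet (β '' A) :=
    hAm.image_of_continuousOn_injOn (hβc.mono hA) (hβinj.mono hA)
  have hS'm : MeasurableSet (appendMeasurableEquiv d d '' ((α '' B) ×ˢ (β '' A))) :=
    fibreAE_measurableSet_image_prod hαBm hβAm
  have himS := swap_image_cylinder hq Φ α β hhead htail hA hB
  have hS'q : appendMeasurableEquiv d d '' ((α '' B) ×ˢ (β '' A)) ⊆ q'.domain := by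
    rw [← himS, himg]
    exact image_mono hSq
  -- Fubini on `S` and on `S'`
  have h1 : ∫ z in appendMeasurableEquiv d d '' (A ×ˢ B), q.integrand z =
      (∫ x in A, p.integrand x) * ∫ w in B, r.integrand w := by
    rw [setIntegral_congr_fun hSm (hqi.mono hSq)]
    exact fibreAE_setIntegral_image_prod_mul _ _ _ _
  have h2 : ∫ z in appendMeasurableEquiv d d '' ((α '' B) ×ˢ (β '' A)), q'.integrand z =
      (∫ x in α '' B, p.integrand x) * ∫ w in β '' A, r'.integrand w := by
    rw [setIntegral_congr_fun hS'm (hq'i.mono hS'q)]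
    exact fibreAE_setIntegral_image_prod_mul _ _ _ _
  -- change of variables for `Φ` on `S`
  have h3 : ∫ z in appendMeasurableEquiv d d '' ((α '' B) ×ˢ (β '' A)), q'.integrand z =
      ∫ z in appendMeasurableEquiv d d '' (A ×ˢ B), q.integrand z := by
    rw [← himS, integral_image_eq_integral_abs_det_fderiv_smul volume hSm
      (fun z hz => (hΦ' z (hSq hz)).mono hSq) (hΦinj.mono hSq)]
    refine setIntegral_congr_fun hSm fun z hz => ?_
    simp only [smul_eq_mul]
    rw [hjac z (hSq hz), mul_comm]
  rw [← h2, h3, h1]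

/-! ### The stub: the measure core of a swap substitution -/

/-- STUB (seat c15). **Measure core of a swap substitution.** Let `q = p ⊗ r`, `q' = p ⊗ r'` be
pinned products whose bases have the dimension of the catalyst `p` (of non-zero value, `r.domain`
non-empty), and let ONE change of variables `Φ : q → q'` be of swap form over `α : σ → K`,
`β : K → σ'` (injective, differentiable within `σ = r.domain` resp. `K = p.domain`). Then
`α σ = K`, `β K = σ'`, the values agree, `r'.value = r.value`, and the SCALED a.e. Jacobian
identities hold: `r.value · k (α w) · |det α' w| = p.value · f w` for a.e. `w ∈ σ` and
`p.value · f' (β x) · |det β' x| = r.value · k x` for a.e. `x ∈ K` — the exchange identity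
`(∫_{αB} k)(∫_{βA} f') = (∫_A k)(∫_B f)` (`swap_exchange_identity`) with `A = K` resp. `B = σ`,
the change of variables for `α` on `B` resp. `β` on `A`, and
`MeasureTheory.Integrable.ae_eq_of_forall_setIntegral_eq`. [cite: KontsevichZagier2001, §1.2 rule (2)] -/
theorem stub_swapSubstitutionAE {d : ℕ} (p : IntegralRep d) (hp : p.value ≠ 0)
    (r r' : IntegralRep d) (hσ : r.domain.Nonempty) (q q' : IntegralRep (d + d))
    (hq : q.domain = {z | (fun i => z (Fin.castAdd d i)) ∈ p.domain ∧
      (fun j => z (Fin.natAdd d j)) ∈ r.domain})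
    (hqi : Set.EqOn q.integrand (fun z => p.integrand (fun i => z (Fin.castAdd d i)) *
      r.integrand (fun j => z (Fin.natAdd d j))) q.domain)
    (hq' : q'.domain = {z | (fun i => z (Fin.castAdd d i)) ∈ p.domain ∧
      (fun j => z (Fin.natAdd d j)) ∈ r'.domain})
    (hq'i : Set.EqOn q'.integrand (fun z => p.integrand (fun i => z (Fin.castAdd d i)) *
      r'.integrand (fun j => z (Fin.natAdd d j))) q'.domain)
    (Φ : (Fin (d + d) → ℝ) → (Fin (d + d) → ℝ))
    (Φ' : (Fin (d + d) → ℝ) → (Fin (d + d) → ℝ) →L[ℝ] (Fin (d + d) → ℝ))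
    (hΦ' : ∀ z ∈ q.domain, HasFDerivWithinAt Φ (Φ' z) q.domain z) (hΦinj : Set.InjOn Φ q.domain)
    (himg : q'.domain = Φ '' q.domain)
    (hjac : ∀ z ∈ q.domain, q.integrand z = q'.integrand (Φ z) * |(Φ' z).det|)
    (α β : (Fin d → ℝ) → (Fin d → ℝ)) (α' β' : (Fin d → ℝ) → (Fin d → ℝ) →L[ℝ] (Fin d → ℝ))
    (hhead : ∀ z ∈ q.domain, (fun i => Φ z (Fin.castAdd d i)) = α (fun j => z (Fin.natAdd d j)))
    (htail : ∀ z ∈ q.domain, (fun j => Φ z (Fin.natAdd d j)) = β (fun i => z (Fin.castAdd d i)))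
    (hα' : ∀ w ∈ r.domain, HasFDerivWithinAt α (α' w) r.domain w)
    (hβ' : ∀ x ∈ p.domain, HasFDerivWithinAt β (β' x) p.domain x)
    (hαinj : Set.InjOn α r.domain) (hβinj : Set.InjOn β p.domain) :
    α '' r.domain = p.domain ∧ β '' p.domain = r'.domain ∧ r'.value = r.value ∧
    (∀ᵐ w ∂(volume.restrict r.domain),
      r.value * (p.integrand (α w) * |(α' w).det|) = p.value * r.integrand w) ∧
    (∀ᵐ x ∂(volume.restrict p.domain),
      p.value * (r'.integrand (β x) * |(β' x).det|) = r.value * p.integrand x) := by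
  have hKm : MeasurableSet p.domain := IntegralRep.measurableSet_domain_holds p
  have hσm : MeasurableSet r.domain := IntegralRep.measurableSet_domain_holds r
  -- points of `K` and `σ`
  have hKne : p.domain.Nonempty := by
    by_contra h
    apply hp
    rw [not_nonempty_iff_eq_empty] at h
    simp [IntegralRep.value, h]
  obtain ⟨x₀, hx₀⟩ := hKne
  obtain ⟨w₀, hw₀⟩ := hσ
  have hmemq : ∀ z, z ∈ q.domain ↔ (fun i => z (Fin.castAdd d i)) ∈ p.domain ∧
      (fun j => z (Fin.natAdd d j)) ∈ r.domain := fun z => by rw [hq]; rfl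
  have hmemq' : ∀ z, z ∈ q'.domain ↔ (fun i => z (Fin.castAdd d i)) ∈ p.domain ∧
      (fun j => z (Fin.natAdd d j)) ∈ r'.domain := fun z => by rw [hq']; rfl
  have happ : ∀ x ∈ p.domain, ∀ w ∈ r.domain, Fin.append x w ∈ q.domain := fun x hx w hw => by
    rw [hmemq]
    simp only [Fin.append_left, Fin.append_right]
    exact ⟨hx, hw⟩
  -- the image of a point of `q.domain` under `Φ`, read in `q'.domain`
  have hΦmem : ∀ x ∈ p.domain, ∀ w ∈ r.domain, α w ∈ p.domain ∧ β x ∈ r'.domain := by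
    intro x hx w hw
    have hz' : Φ (Fin.append x w) ∈ q'.domain := himg ▸ mem_image_of_mem Φ (happ x hx w hw)
    rw [hmemq', hhead _ (happ x hx w hw), htail _ (happ x hx w hw)] at hz'
    simp only [Fin.append_left, Fin.append_right] at hz'
    exact hz'
  -- (1) `α σ = K` and `β K = σ'`
  have hαK : α '' r.domain = p.domain := by
    apply Subset.antisymm
    · rintro _ ⟨w, hw, rfl⟩
      exact (hΦmem x₀ hx₀ w hw).1
    · intro x hx
      have hz' : Fin.append x (β x₀) ∈ q'.domain := by
        rw [hmemq']
        simp only [Fin.append_left, Fin.append_right]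
        exact ⟨hx, (hΦmem x₀ hx₀ w₀ hw₀).2⟩
      rw [himg] at hz'
      obtain ⟨z, hz, hzx⟩ := hz'
      refine ⟨fun j => z (Fin.natAdd d j), ((hmemq z).1 hz).2, ?_⟩
      rw [← hhead z hz, hzx]
      funext i
      exact Fin.append_left x (β x₀) i
  have hβσ' : β '' p.domain = r'.domain := by
    apply Subset.antisymm
    · rintro _ ⟨x, hx, rfl⟩
      exact (hΦmem x hx w₀ hw₀).2
    · intro w' hw'
      have hz' : Fin.append x₀ w' ∈ q'.domain := by
        rw [hmemq']
        simp only [Fin.append_left, Fin.append_right]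
        exact ⟨hx₀, hw'⟩
      rw [himg] at hz'
      obtain ⟨z, hz, hzw⟩ := hz'
      refine ⟨fun i => z (Fin.castAdd d i), ((hmemq z).1 hz).1, ?_⟩
      rw [← htail z hz, hzw]
      funext j
      exact Fin.append_right x₀ w' j
  -- the exchange identity
  have hex := fun (A : Set (Fin d → ℝ)) (hAm : MeasurableSet A) (hA : A ⊆ p.domain)
      (B : Set (Fin d → ℝ)) (hBm : MeasurableSet B) (hB : B ⊆ r.domain) =>
    swap_exchange_identity p r r' q q' hq hqi hq'i Φ Φ' hΦ' hΦinj himg hjac α β α' β' hhead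
      htail hα' hβ' hαinj hβinj hAm hA hBm hB
  -- (2) the values agree
  have hv : r'.value = r.value := by
    have h := hex p.domain hKm Subset.rfl r.domain hσm Subset.rfl
    rw [hαK, hβσ'] at h
    -- h : p.value * r'.value = p.value * r.value
    exact mul_left_cancel₀ hp h
  refine ⟨hαK, hβσ', hv, ?_, ?_⟩
  · -- (3) the identity on `σ`: test with `A = K`, `B ⊆ σ`, change variables along `α` on `B`
    have key : ∀ B : Set (Fin d → ℝ), MeasurableSet B → B ⊆ r.domain →
        ∫ w in B, r.value * (|(α' w).det| • p.integrand (α w)) =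
          ∫ w in B, p.value * r.integrand w := by
      intro B hBm hB
      have h := hex p.domain hKm Subset.rfl B hBm hB
      rw [hβσ'] at h
      -- h : (∫ x in α '' B, k) * r'.value = p.value * ∫ w in B, f
      have h4 : ∫ x in α '' B, p.integrand x = ∫ w in B, |(α' w).det| • p.integrand (α w) :=
        integral_image_eq_integral_abs_det_fderiv_smul volume hBm
          (fun w hw => (hα' w (hB hw)).mono hB) (hαinj.mono hB) _
      rw [integral_const_mul, integral_const_mul, ← h4, mul_comm, ← hv]
      exact h
    have hg : IntegrableOn (fun w => |(α' w).det| • p.integrand (α w)) r.domain :=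
      (integrableOn_image_iff_integrableOn_abs_det_fderiv_smul volume hσm hα' hαinj
        p.integrand).mp (p.integrableOn.mono_set hαK.subset)
    have hae : (fun w => r.value * (|(α' w).det| • p.integrand (α w))) =ᵐ[volume.restrict r.domain]
        fun w => p.value * r.integrand w := by
      refine Integrable.ae_eq_of_forall_setIntegral_eq _ _ (hg.integrable.const_mul _)
        (r.integrableOn.integrable.const_mul _) fun s hs _ => ?_
      rw [Measure.restrict_restrict hs]
      exact key (s ∩ r.domain) (hs.inter hσm) inter_subset_right
    filter_upwards [hae] with w hw
    rw [← hw, smul_eq_mul, mul_comm |(α' w).det|]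
  · -- (4) the identity on `K`: test with `A ⊆ K`, `B = σ`, change variables along `β` on `A`
    have key : ∀ A : Set (Fin d → ℝ), MeasurableSet A → A ⊆ p.domain →
        ∫ x in A, p.value * (|(β' x).det| • r'.integrand (β x)) =
          ∫ x in A, r.value * p.integrand x := by
      intro A hAm hA
      have h := hex A hAm hA r.domain hσm Subset.rfl
      rw [hαK] at h
      -- h : p.value * ∫ w in β '' A, f' = (∫ x in A, k) * r.value
      have h4 : ∫ w in β '' A, r'.integrand w = ∫ x in A, |(β' x).det| • r'.integrand (β x) :=
        integral_image_eq_integral_abs_det_fderiv_smul volume hAm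
          (fun x hx => (hβ' x (hA hx)).mono hA) (hβinj.mono hA) _
      rw [integral_const_mul, integral_const_mul, ← h4, mul_comm r.value]
      exact h
    have hg : IntegrableOn (fun x => |(β' x).det| • r'.integrand (β x)) p.domain :=
      (integrableOn_image_iff_integrableOn_abs_det_fderiv_smul volume hKm hβ' hβinj
        r'.integrand).mp (r'.integrableOn.mono_set hβσ'.subset)
    have hae : (fun x => p.value * (|(β' x).det| • r'.integrand (β x))) =ᵐ[volume.restrict p.domain]
        fun x => r.value * p.integrand x := by
      refine Integrable.ae_eq_of_forall_setIntegral_eq _ _ (hg.integrable.const_mul _)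
        (p.integrableOn.integrable.const_mul _) fun s hs _ => ?_
      rw [Measure.restrict_restrict hs]
      exact key (s ∩ p.domain) (hs.inter hKm) inter_subset_right
    filter_upwards [hae] with x hx
    rw [← hx, smul_eq_mul, mul_comm |(β' x).det|]

end Summit.KontsevichZagierPeriods.KontsevichZagierPeriods.BetaCancellationLine

end
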